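/- COR-CM (cell pub-hodgecm2) — Δ2 BRIDGE, ORIENTATION AUDIT, TEST T2 — SEQUEL «STARVATION» (wall-breaker wb-9, prover-pub-hodgecm2-d2bridge-wb-9-g0-0,
TRANSPORT route).  THEOREMS ONLY; nothing landed is edited or restated; no named fact, no `sorry`.  HC_CM is NOT proved; «Δ2 BRIDGE CLOSED» is NOT claimed. -/
import Summits.HodgeConjecture.CorCM.D2Bridge.OrientationT2BlockVanishing
import HarnessLib

/-!
# Δ2 bridge, orientation test T2 — sequel: `Thm418C` + (T1) + (D) STARVE the junction's theta input

`OrientationT2BlockVanishing` shows: at the tower-built dictionary (in particular the pinned dictionary of the END), `Thm418C` + (T1)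
«CM classes of type `(1,0)`» + (D) «the block restricts into `(0,1)`» force `block j = ⊥` at every `PhiMu` character `j`.  Here:
if the blocks of a finite `PhiMu` family `S` vanish, then every class `ω ∈ H¹(P_Γ; ℂ)` fed to the dictionary through `S` in the shape of
E's `hJS` ∕ `hIso` binder — `∃ cf ∈ H_K, res cf = ω ∧ ofLevel cf ∈ ⨆ j ∈ S, block j` (`LiuDictionaryPin.hsmall_of_pin_at_of_lineType_eq`,
`LiuDictionaryTower.hIso_of_families`) — is ZERO (`ofLevel` is injective).  So under a typed (D) the (J3) junction receives only the
zero theta class at `PhiMu` slot lines: the Hodge-typed form of «the junction STARVES» (REKEY-IMPACT §0 (J)), modulo (D).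
-/

set_option autoImplicit false
noncomputable section

namespace Summit.HodgeConjecture.CorCM.D2Bridge

open HodgeCM HodgeCM.Model
open HodgeCM.Literature.Theta HodgeCM.Literature.Theta.LiuAlbaneseModuleDatum
open Literature.AlgebraicGeometry.HodgeTheory
open Literature.NumberTheory.Automorphic.PicardCM

variable {L : CMField} {ι₁ : L →+* ℂ} {V : HermSpace3 L ι₁}

section Starve

open HodgeCM.Model.TowerCarrier HodgeCM.Model.TowerLevel
open Literature.NumberTheory.Transcendental (Arapura2012_Cor_15_4_6)

variable (V)
variable (Char : Type) (Adm : Char → Type) (Ω : (μ : Char) → Adm μ → Type)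
    [∀ μ a, AddCommGroup (Ω μ a)] [∀ μ a, Module ℂ (Ω μ a)] [∀ μ a, Module (adelicAlgebra V) (Ω μ a)]
    [∀ μ a, IsScalarTower ℂ (adelicAlgebra V) (Ω μ a)] (PhiMu : Char → Prop) (adm : Char → LiuCMSide → Prop)

/-- **Starvation of the junction's `hJS` ∕ `hIso` input.**  If the blocks of a finite family `S` of characters all vanish, then every
level-`Γ` family `cf ∈ H_K` whose image in the tower lies in `⨆ j ∈ S, block j` is `0`, and so is its identity-component class
`res cf` — the shape `∃ cf, res cf = ω ∧ ofLevel cf ∈ ⨆ j ∈ S, block j` in which Stage 1 feeds its theta classes `ω` to the dictionary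
(`LiuDictionaryPin.hsmall_of_pin_at_of_lineType_eq`, binder `hJS`). [folklore] -/
theorem towerLevel_res_eq_zero_of_blocks_eq_bot
    (hHD : exists_isReal_hodgeModel) (hI : hodgePQ_independent_of_hodgeModel)
    (h₁ : BallQuotientUniformised) (h₃ : CMAbelianVarietyRealised) (hA : Arapura2012_Cor_15_4_6)
    (S : Finset Char) (hS : ∀ j ∈ S, (LiuDictionary.ofTower hHD hI h₁ h₃ hA V Char Adm Ω PhiMu adm).block j = ⊥)
    {Γ : Level V} (hΓ : Γ.BelowConjThree)
    (cf : towerLevel hHD hI (ballQuotientUniformisedDatum_of h₁) h₃ hA Γ hΓ)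
    (hcf : (ofLevel hHD hI (ballQuotientUniformisedDatum_of h₁) h₃ hA Γ hΓ cf :
        (LiuDictionary.ofTower hHD hI h₁ h₃ hA V Char Adm Ω PhiMu adm).H) ∈
      ⨆ j ∈ S, (LiuDictionary.ofTower hHD hI h₁ h₃ hA V Char Adm Ω PhiMu adm).block j) :
    cf = 0 ∧ TowerLevel.res hHD hI (ballQuotientUniformisedDatum_of h₁) h₃ hA cf = 0 := by
  have hbot : (⨆ j ∈ S, (LiuDictionary.ofTower hHD hI h₁ h₃ hA V Char Adm Ω PhiMu adm).block j) = ⊥ :=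
    le_bot_iff.1 (iSup₂_le fun j hj => (hS j hj).le)
  rw [hbot, Submodule.mem_bot] at hcf
  have hcf0 : cf = 0 :=
    ofLevel_injective hHD hI (ballQuotientUniformisedDatum_of h₁) h₃ hA Γ hΓ (by rw [map_zero]; exact hcf)
  exact ⟨hcf0, by rw [hcf0, map_zero]⟩

/-- **T2 ⟹ STARVATION.**  `Thm418C` + (T1) and (D) at every character of a finite `PhiMu` family `S` ⟹ every class `ω` on an identity
component `P_Γ` fed to the dictionary through `S` in the `hJS` shape (`∃ cf ∈ H_K, res cf = ω ∧ ofLevel cf ∈ ⨆ j ∈ S, block j`) is ZERO.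
[cite: VoisinHodgeI2002, §6.1.3 Cor. 6.14] -/
theorem hJS_class_eq_zero_of_thm418C_of_hodgeTypes
    (hHD : exists_isReal_hodgeModel) (hI : hodgePQ_independent_of_hodgeModel)
    (h₁ : BallQuotientUniformised) (h₃ : CMAbelianVarietyRealised) (hA : Arapura2012_Cor_15_4_6)
    (h418 : (LiuDictionary.ofTower hHD hI h₁ h₃ hA V Char Adm Ω PhiMu adm).Thm418C)
    (S : Finset Char) (hΦ : ∀ j ∈ S, PhiMu j)
    (hT1 : ∀ j ∈ S, ∀ Γ : Level V, (LiuDictionary.ofTower hHD hI h₁ h₃ hA V Char Adm Ω PhiMu adm).cmClasses Γ j ⊆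
      ((picardCMUniverse hHD hI h₁ h₃).hodge ((picardCMUniverse hHD hI h₁ h₃).pms L ι₁ V Γ) 1).piece 1 0)
    (hD : ∀ j ∈ S, ∃ Γ₁ : Level V, ∀ Γ ≤ Γ₁, ∀ x ∈ (LiuDictionary.ofTower hHD hI h₁ h₃ hA V Char Adm Ω PhiMu adm).block j,
      x ∈ fixedBy Γ.K (LiuDictionary.ofTower hHD hI h₁ h₃ hA V Char Adm Ω PhiMu adm).H →
        (LiuDictionary.ofTower hHD hI h₁ h₃ hA V Char Adm Ω PhiMu adm).res Γ x ∈
          ((picardCMUniverse hHD hI h₁ h₃).hodge ((picardCMUniverse hHD hI h₁ h₃).pms L ι₁ V Γ) 1).piece 0 1)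
    {Γ : Level V} (hΓ : Γ.BelowConjThree)
    (ω : (picardCMUniverse hHD hI h₁ h₃).CohC ((picardCMUniverse hHD hI h₁ h₃).pms L ι₁ V Γ) 1)
    (hJS : ∃ cf : towerLevel hHD hI (ballQuotientUniformisedDatum_of h₁) h₃ hA Γ hΓ,
      TowerLevel.res hHD hI (ballQuotientUniformisedDatum_of h₁) h₃ hA cf = ω ∧
        (ofLevel hHD hI (ballQuotientUniformisedDatum_of h₁) h₃ hA Γ hΓ cf :
            (LiuDictionary.ofTower hHD hI h₁ h₃ hA V Char Adm Ω PhiMu adm).H) ∈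
          ⨆ j ∈ S, (LiuDictionary.ofTower hHD hI h₁ h₃ hA V Char Adm Ω PhiMu adm).block j) :
    ω = 0 := by
  obtain ⟨cf, hres, hcf⟩ := hJS
  have hS : ∀ j ∈ S, (LiuDictionary.ofTower hHD hI h₁ h₃ hA V Char Adm Ω PhiMu adm).block j = ⊥ := fun j hj =>
    block_ofTower_eq_bot_of_thm418C_of_hodgeTypes V Char Adm Ω PhiMu adm hHD hI h₁ h₃ hA j h418 (hΦ j hj) (hT1 j hj) (hD j hj)
  rw [← hres]
  exact (towerLevel_res_eq_zero_of_blocks_eq_bot V Char Adm Ω PhiMu adm hHD hI h₁ h₃ hA S hS hΓ cf hcf).2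

end Starve

/-! ## At THE PINNED DICTIONARY of the END -/

section Pin

open HodgeCM.Model.TowerCarrier HodgeCM.Model.TowerLevel
open Literature.NumberTheory.Transcendental (Arapura2012_Cor_15_4_6)

variable (V) (I : Type) (line : I → SplitLineE V)

/-- **T2 ⟹ STARVATION AT THE LITERAL PIN.**  For the pinned dictionary `𝔇 := liuDictionaryPin … V I line`: `𝔇.Thm418C` + (T1) and (D)
at every line of a finite family `S` of `PhiMu` index lines ⟹ every class `ω ∈ H¹(P_Γ; ℂ)` with an `hJS`-witness through `S`
(`∃ cf ∈ H_K, res cf = ω ∧ ofLevel cf ∈ ⨆ j ∈ S, 𝔇.block j`) is `0`. [cite: VoisinHodgeI2002, §6.1.3 Cor. 6.14] -/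
theorem hJS_class_pin_eq_zero_of_thm418C_of_hodgeTypes
    (hHD : exists_isReal_hodgeModel) (hI : hodgePQ_independent_of_hodgeModel)
    (h₁ : BallQuotientUniformised) (h₃ : CMAbelianVarietyRealised) (hA : Arapura2012_Cor_15_4_6)
    (h418 : (liuDictionaryPin hHD hI h₁ h₃ hA V I line).Thm418C)
    (S : Finset I) (hΦ : ∀ j ∈ S, SplitLine.PhiMuLine ι₁ (line j))
    (hT1 : ∀ j ∈ S, ∀ Γ : Level V, (liuDictionaryPin hHD hI h₁ h₃ hA V I line).cmClasses Γ j ⊆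
      ((picardCMUniverse hHD hI h₁ h₃).hodge ((picardCMUniverse hHD hI h₁ h₃).pms L ι₁ V Γ) 1).piece 1 0)
    (hD : ∀ j ∈ S, ∃ Γ₁ : Level V, ∀ Γ ≤ Γ₁, ∀ x ∈ (liuDictionaryPin hHD hI h₁ h₃ hA V I line).block j,
      x ∈ fixedBy Γ.K (liuDictionaryPin hHD hI h₁ h₃ hA V I line).H →
        (liuDictionaryPin hHD hI h₁ h₃ hA V I line).res Γ x ∈
          ((picardCMUniverse hHD hI h₁ h₃).hodge ((picardCMUniverse hHD hI h₁ h₃).pms L ι₁ V Γ) 1).piece 0 1)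
    {Γ : Level V} (hΓ : Γ.BelowConjThree)
    (ω : (picardCMUniverse hHD hI h₁ h₃).CohC ((picardCMUniverse hHD hI h₁ h₃).pms L ι₁ V Γ) 1)
    (hJS : ∃ cf : towerLevel hHD hI (ballQuotientUniformisedDatum_of h₁) h₃ hA Γ hΓ,
      TowerLevel.res hHD hI (ballQuotientUniformisedDatum_of h₁) h₃ hA cf = ω ∧
        (ofLevel hHD hI (ballQuotientUniformisedDatum_of h₁) h₃ hA Γ hΓ cf :
            (liuDictionaryPin hHD hI h₁ h₃ hA V I line).H) ∈
          ⨆ j ∈ S, (liuDictionaryPin hHD hI h₁ h₃ hA V I line).block j) :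
    ω = 0 :=
  hJS_class_eq_zero_of_thm418C_of_hodgeTypes V I _ _ _ _ hHD hI h₁ h₃ hA h418 S hΦ hT1 hD hΓ ω hJS

end Pin


end Summit.HodgeConjecture.CorCM.D2Bridge

end
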